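import Summits.ResolutionOfSingularities.ResolutionOfSingularities.Theorems.FrobeniusLadderFInjectiveMacaulayficationFullCentreDescentRegular
import Summits.ResolutionOfSingularities.ResolutionOfSingularities.Theorems.FrobeniusLadderFInjectiveMacaulayficationIntrinsicTower
import Literature.AlgebraicGeometry.Resolution.BlowupsFlatBaseChange
import Literature.AlgebraicGeometry.Resolution.NormalCrossingsLocal
import HarnessLib

/-!
# THE LOCAL PERSISTENCE KIT — the kernel RECEIVER for chart-level loop certificates against tower-termination statements (K-TT-a / K-RR-a)
# (crux `FInjectiveMacaulayfication` stmt-ResolutionOfSingularities-15315, chain w45a; res-L1-w45a-lead-1 g9 (P-KIT), res-L1-w45a-plan-1 RULING R19.10 (1) GO; continuing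
# `…FullCentreDescentRegular` §2
# `not_exists_tower_of_persistent`; serves res-L1-w45a-plan-1 R19.2 (6) / R19.4 (6) / R19.6 (4) / R19.8 (5) kill criteria for `IntrinsicTower.Recipes.TowerTerminates c` and
# `RegTower.RegTowerTerminates c`)

[OURS · L1 W4.5a] Support file (`--supports stmt-ResolutionOfSingularities-15315 --as helper`); NOT a statement of any manuscript; def-free, fact-free, UNCONDITIONAL; generic
(no specimen, no recipe is evaluated). AI-written (AI review is weaker than expert review).

WHAT IS PROVED. A tower engine refutes «some tower along the recipe `c` from the floor `S′` ends `Q` everywhere» by exhibiting a RECURRENT CHART: an open piece `U₀` carrying a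
non-`Q` point which re-appears, as an open piece, inside the blowing up of `U₀` along the recipe's own centre («floor n+1 contains a copy of the bad chart of floor n» — a
period-one loop; res-L1-w45a-idea-1 FB5-r6 §1.5 reports one for the N-recipe on d4lx6c3, floor 5 = floor 6). This file turns such a certificate into `¬ ∃ n, T n S` for EVERY
floor `S` containing an open copy of `U₀`:
* §1 ★ `not_exists_tower_of_recurrent_chart (Q) (hQ) (T c h0 hsucc) (hloc) (U₀) (hU₀) (hrec)` (+ ★ the ONE-CHART CERTIFICATE form `…_recurrent_chart₁ (hπ₀ : IsBlowup π₀ (c U₀)) (j₀ : U₀ ⟶ B₀)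
  [IsOpenImmersion j₀]`, R19.10 (1) target shape «the blow-up of U₀ along the recipe's centre contains an open chart isomorphic to U₀», via uniqueness of blowing ups
  `forall_isBlowup_exists_isOpenImmersion_of_one`; and `not_exists_regularTower_of_recurrent_chart₁` with `Q` := regularity discharged) — via `FullCentreDescent.not_exists_tower_of_persistent` with the persistent property
  `P S := ∃ j : U₀ ⟶ S, IsOpenImmersion j`: a non-`Q` point of `U₀` stays non-`Q` in `S` (stalk isomorphism), and the blowing up `S₁ → S` along `c S` pulls back over `U₀` to a
  blowing up of `U₀` along `(c S)|U₀ = c U₀` (flat base change `IsBlowup.pullback_snd_of_flat` + the LOCALITY of the recipe `hloc`), which receives an open copy of `U₀` by the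
  certificate `hrec`, whence so does `S₁` (`pullback.fst` of an open immersion is one). Hypotheses on the recipe: ONLY `hloc : (c S).comap j = c U` for open immersions `j : U ⟶ S`.
* §2 LOCALITY of the reduced-closure recipes: `comap_vanishingIdeal_closure_of_isOpenImmersion (L) (hL)` — for any point-locus `L : ∀ S, Set S` with `j⁻¹(L S) = L U` along open
  immersions, the recipe `S ↦ vanishingIdeal (closure (L S))` satisfies `hloc` (`comap_vanishingIdeal_of_isOpenImmersion` + «open maps pull closures back to closures»); instances:
  `preimage_compl_regularLocus` (L := (Reg ·)ᶜ — the recipe `RegTower.singCentre`, literally), `preimage_nonFullLocus` (L := `IntrinsicTower.nonFullLocus p`), and their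
  intersection (the recipe `IntrinsicTower.Recipes.nonFullCentre`, literally) — ★ `singCentre_local`, `nonFullCentreLiteral_local`, `intrinsicCentre_local` (v1 `IntrinsicTower.centre`).
* §1b ★★ `not_exists_tower_of_recurrent_family{,₁}` — the SAME for a FAMILY of bad charts `U : ι → Scheme` closed under the recipe up to open immersion (`hrec`, or one certified
  blowing up + one open immersion `U (next i) ⟶ B i` per chart): PERIOD-r CYCLES (`ι := Fin r` / `Bool` — the rad-τ 2-cycle `L ⇄ M` of res-L1-w45a-idea-1 FB5-r7 / res-L1-w45a-tri-2
  g16) and ESCALATORS (`ι := ℕ`, FB5-r6's `G_k`) alike; regularity and FULL versions with `hQ` discharged.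
NOT COVERED (honest): the rad-τ recipe `tauCentre` needs transport of the instance-free test ideal `testIdeal'` along stalk isomorphisms for its `hloc` (routine but not typed
here), and every use still requires the chart-level identification of the recipe's
centre on `U₀` (for FULL: Fedder-type criteria, R19.7-DEFERRED-1), which is where the mathematics of a kill lives. Nothing of the crux is proved or refuted here.
[folklore assembly; cite: GortzWedhorn2020, Prop. 13.91 (2)] [cite: StacksProject, Tag 080B; Tag 01J3]
-/

-- single-problem summit: the doubled namespace component is forced
set_option linter.dupNamespace false

noncomputable section

open AlgebraicGeometry CategoryTheory CategoryTheory.Limits Literature.AlgebraicGeometry.Resolution TopologicalSpace IsLocalRing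

namespace Summit.ResolutionOfSingularities.ResolutionOfSingularities.Theorems.FInjectiveMacaulayfication.FullCentreDescent

open Summit.ResolutionOfSingularities.ResolutionOfSingularities.Theorems.FInjectiveMacaulayfication
open SliceableCentre

/-! ## §1 A recurrent chart refutes every tower -/

/-- **THE RECURRENT-CHART LEMMA.** `Q` a stalk-local point property (descending along isomorphic stalk maps), `T`/`c` a tower predicate and its centre recipe (`T 0 ⇒ Q`
everywhere; `T (n+1) S ⇒ T n` on every blowing up along `c S`), the recipe LOCAL for open immersions (`hloc`). If an open chart `U₀` has a non-`Q` point (`hU₀`) and EVERY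
blowing up of `U₀` along `c U₀` receives an open immersion from `U₀` (`hrec` — the loop certificate), then NO scheme containing an open copy of `U₀` has a tower of any height
ending `Q` everywhere. [folklore assembly; OURS] [cite: GortzWedhorn2020, Prop. 13.91 (2)] -/
theorem not_exists_tower_of_recurrent_chart (Q : (S : Scheme.{0}) → S → Prop)
    (hQ : ∀ {X Y : Scheme.{0}} (π : X ⟶ Y) (x : X) [IsIso (π.stalkMap x)], Q Y (π.base x) → Q X x)
    (T : ℕ → Scheme.{0} → Prop) (c : (S : Scheme.{0}) → S.IdealSheafData)
    (h0 : ∀ (S : Scheme.{0}), T 0 S → ∀ s : S, Q S s)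
    (hsucc : ∀ (n : ℕ) (S : Scheme.{0}), T (n + 1) S → ∀ (S₁ : Scheme.{0}) (g : S₁ ⟶ S), IsBlowup g (c S) → T n S₁)
    (hloc : ∀ {U S : Scheme.{0}} (j : U ⟶ S) [IsOpenImmersion j], (c S).comap j = c U)
    (U₀ : Scheme.{0}) (hU₀ : ∃ u : U₀, ¬ Q U₀ u)
    (hrec : ∀ (B : Scheme.{0}) (π : B ⟶ U₀), IsBlowup π (c U₀) → ∃ j : U₀ ⟶ B, IsOpenImmersion j)
    (S : Scheme.{0}) (hS : ∃ j : U₀ ⟶ S, IsOpenImmersion j) : ¬ ∃ n : ℕ, T n S := by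
  refine not_exists_tower_of_persistent Q T c h0 hsucc (fun S => ∃ j : U₀ ⟶ S, IsOpenImmersion j) ?_ ?_ S hS
  · rintro S' ⟨j, hj⟩
    obtain ⟨u, hu⟩ := hU₀
    refine ⟨j.base u, fun h => hu ?_⟩
    haveI : IsIso (j.stalkMap u) := isIso_stalkMap_of_flat_of_isPreimmersion j u
    exact hQ j u h
  · rintro S' ⟨j, hj⟩
    obtain ⟨S₁, g, hg⟩ := exists_isBlowup S' (c S')
    have hsnd : IsBlowup (pullback.snd g j) ((c S').comap j) := hg.pullback_snd_of_flat j
    rw [hloc j] at hsnd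
    obtain ⟨j', hj'⟩ := hrec _ _ hsnd
    exact ⟨S₁, g, hg, j' ≫ pullback.fst g j, inferInstance⟩

/-- The same with the conclusion for the chart itself (`S := U₀`, `j := 𝟙`). [OURS] -/
theorem not_exists_tower_of_recurrent_chart_self (Q : (S : Scheme.{0}) → S → Prop)
    (hQ : ∀ {X Y : Scheme.{0}} (π : X ⟶ Y) (x : X) [IsIso (π.stalkMap x)], Q Y (π.base x) → Q X x)
    (T : ℕ → Scheme.{0} → Prop) (c : (S : Scheme.{0}) → S.IdealSheafData)
    (h0 : ∀ (S : Scheme.{0}), T 0 S → ∀ s : S, Q S s)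
    (hsucc : ∀ (n : ℕ) (S : Scheme.{0}), T (n + 1) S → ∀ (S₁ : Scheme.{0}) (g : S₁ ⟶ S), IsBlowup g (c S) → T n S₁)
    (hloc : ∀ {U S : Scheme.{0}} (j : U ⟶ S) [IsOpenImmersion j], (c S).comap j = c U)
    (U₀ : Scheme.{0}) (hU₀ : ∃ u : U₀, ¬ Q U₀ u)
    (hrec : ∀ (B : Scheme.{0}) (π : B ⟶ U₀), IsBlowup π (c U₀) → ∃ j : U₀ ⟶ B, IsOpenImmersion j) :
    ¬ ∃ n : ℕ, T n U₀ :=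
  not_exists_tower_of_recurrent_chart Q hQ T c h0 hsucc hloc U₀ hU₀ hrec U₀ ⟨𝟙 U₀, inferInstance⟩

/-- **ONE CERTIFIED BLOWING UP SUFFICES** (the ONE-CHART certificate form, R19.10 (1) target shape: «the blow-up of `U₀` along the recipe's centre contains an open chart
isomorphic to `U₀`»): if SOME blowing up `π₀ : B₀ → U₀` along `c U₀` receives an open immersion `j₀ : U₀ ⟶ B₀`, then EVERY blowing up along `c U₀` does (uniqueness of blowing ups
up to isomorphism over the base). [folklore] [cite: GortzWedhorn2020, (13.19) p. 413] -/
theorem forall_isBlowup_exists_isOpenImmersion_of_one {U₀ : Scheme.{0}} (J : U₀.IdealSheafData)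
    {B₀ : Scheme.{0}} {π₀ : B₀ ⟶ U₀} (hπ₀ : IsBlowup π₀ J) (j₀ : U₀ ⟶ B₀) [IsOpenImmersion j₀] :
    ∀ (B : Scheme.{0}) (π : B ⟶ U₀), IsBlowup π J → ∃ j : U₀ ⟶ B, IsOpenImmersion j := by
  intro B π hπ
  obtain ⟨e, -, -⟩ := hπ₀.unique hπ
  exact ⟨j₀ ≫ e.hom, inferInstance⟩

/-- **THE RECURRENT-CHART LEMMA, ONE-CHART CERTIFICATE FORM**: a non-`Q` open chart `U₀`, ONE blowing up `π₀ : B₀ → U₀` along the recipe's centre `c U₀` and ONE open immersion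
`U₀ ⟶ B₀` refute every tower from every floor containing an open copy of `U₀`. This is the shape a machine certificate takes (one Rees chart of one blowing up, identified with the
original chart up to renaming — cf. the Nash-blow-up loops on toric 4-folds of Castillo–Duarte–Leyton-Álvarez–Liendo, found by a chart search). [folklore assembly; OURS] -/
theorem not_exists_tower_of_recurrent_chart₁ (Q : (S : Scheme.{0}) → S → Prop)
    (hQ : ∀ {X Y : Scheme.{0}} (π : X ⟶ Y) (x : X) [IsIso (π.stalkMap x)], Q Y (π.base x) → Q X x)
    (T : ℕ → Scheme.{0} → Prop) (c : (S : Scheme.{0}) → S.IdealSheafData)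
    (h0 : ∀ (S : Scheme.{0}), T 0 S → ∀ s : S, Q S s)
    (hsucc : ∀ (n : ℕ) (S : Scheme.{0}), T (n + 1) S → ∀ (S₁ : Scheme.{0}) (g : S₁ ⟶ S), IsBlowup g (c S) → T n S₁)
    (hloc : ∀ {U S : Scheme.{0}} (j : U ⟶ S) [IsOpenImmersion j], (c S).comap j = c U)
    (U₀ : Scheme.{0}) (hU₀ : ∃ u : U₀, ¬ Q U₀ u)
    {B₀ : Scheme.{0}} {π₀ : B₀ ⟶ U₀} (hπ₀ : IsBlowup π₀ (c U₀)) (j₀ : U₀ ⟶ B₀) [IsOpenImmersion j₀]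
    (S : Scheme.{0}) (hS : ∃ j : U₀ ⟶ S, IsOpenImmersion j) : ¬ ∃ n : ℕ, T n S :=
  not_exists_tower_of_recurrent_chart Q hQ T c h0 hsucc hloc U₀ hU₀ (forall_isBlowup_exists_isOpenImmersion_of_one (c U₀) hπ₀ j₀) S hS

/-- **REGULARITY VERSION** (for `RegTower.TowerRegular c p` / `RegTower.RegTowerTerminates`, R19.8 K-RR-a; `T`, `c` abstract so that no import of the RR file is needed — instantiate with
`T := RegTower.TowerRegular c p`, `h0 := fun _ h => h`, `hsucc := fun _ _ h => h`, `hloc := singCentre_local` below for `c := RegTower.singCentre p`): a recurrent SINGULAR chart refutes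
every regularizing tower. [folklore assembly; OURS] -/
theorem not_exists_regularTower_of_recurrent_chart₁ (T : ℕ → Scheme.{0} → Prop) (c : (S : Scheme.{0}) → S.IdealSheafData)
    (h0 : ∀ (S : Scheme.{0}), T 0 S → ∀ s : S, s ∈ Scheme.regularLocus S)
    (hsucc : ∀ (n : ℕ) (S : Scheme.{0}), T (n + 1) S → ∀ (S₁ : Scheme.{0}) (g : S₁ ⟶ S), IsBlowup g (c S) → T n S₁)
    (hloc : ∀ {U S : Scheme.{0}} (j : U ⟶ S) [IsOpenImmersion j], (c S).comap j = c U)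
    (U₀ : Scheme.{0}) (hU₀ : ∃ u : U₀, u ∉ Scheme.regularLocus U₀)
    {B₀ : Scheme.{0}} {π₀ : B₀ ⟶ U₀} (hπ₀ : IsBlowup π₀ (c U₀)) (j₀ : U₀ ⟶ B₀) [IsOpenImmersion j₀]
    (S : Scheme.{0}) (hS : ∃ j : U₀ ⟶ S, IsOpenImmersion j) : ¬ ∃ n : ℕ, T n S :=
  not_exists_tower_of_recurrent_chart₁ (fun S s => s ∈ Scheme.regularLocus S) (fun π x _ h => mem_regularLocus_descends π x h)
    T c h0 hsucc hloc U₀ hU₀ hπ₀ j₀ S hS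

/-! ### §1b Cycles and escalators: a recurrent FAMILY of charts

res-L1-w45a-tri-2 g16 (l.≈80990, replaying res-L1-w45a-idea-1 g23 FB5-r7): the rad-τ recipe has an abstract PERIOD-TWO cycle `L ⇄ M` of 4-fold hypersurface charts over `𝔽₂`;
escalators (`G_k ↦ G_{k+1}`, FB5-r6) are infinite families. Both are covered by indexing the bad charts by an arbitrary type `ι` (a `Fin 2`-cycle, an `ℕ`-escalator, …) and taking
the persistent property `P S := ∃ i, U i ↪ S open`. -/

/-- **THE RECURRENT-FAMILY LEMMA.** A family of charts `U i`, each with a non-`Q` point, such that every blowing up of every `U i` along the recipe's centre receives an open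
immersion from SOME `U i'` (`hrec`), refutes every tower from every floor containing an open copy of some `U i`. Period-`r` cycles: `ι := Fin r`; escalators: `ι := ℕ`.
[folklore assembly; OURS] [cite: GortzWedhorn2020, Prop. 13.91 (2)] -/
theorem not_exists_tower_of_recurrent_family (Q : (S : Scheme.{0}) → S → Prop)
    (hQ : ∀ {X Y : Scheme.{0}} (π : X ⟶ Y) (x : X) [IsIso (π.stalkMap x)], Q Y (π.base x) → Q X x)
    (T : ℕ → Scheme.{0} → Prop) (c : (S : Scheme.{0}) → S.IdealSheafData)
    (h0 : ∀ (S : Scheme.{0}), T 0 S → ∀ s : S, Q S s)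
    (hsucc : ∀ (n : ℕ) (S : Scheme.{0}), T (n + 1) S → ∀ (S₁ : Scheme.{0}) (g : S₁ ⟶ S), IsBlowup g (c S) → T n S₁)
    (hloc : ∀ {U S : Scheme.{0}} (j : U ⟶ S) [IsOpenImmersion j], (c S).comap j = c U)
    {ι : Type} (U : ι → Scheme.{0}) (hU : ∀ i, ∃ u : U i, ¬ Q (U i) u)
    (hrec : ∀ (i : ι) (B : Scheme.{0}) (π : B ⟶ U i), IsBlowup π (c (U i)) → ∃ (i' : ι) (j : U i' ⟶ B), IsOpenImmersion j)
    (S : Scheme.{0}) (hS : ∃ (i : ι) (j : U i ⟶ S), IsOpenImmersion j) : ¬ ∃ n : ℕ, T n S := by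
  refine not_exists_tower_of_persistent Q T c h0 hsucc (fun S => ∃ (i : ι) (j : U i ⟶ S), IsOpenImmersion j) ?_ ?_ S hS
  · rintro S' ⟨i, j, hj⟩
    obtain ⟨u, hu⟩ := hU i
    refine ⟨j.base u, fun h => hu ?_⟩
    haveI : IsIso (j.stalkMap u) := isIso_stalkMap_of_flat_of_isPreimmersion j u
    exact hQ j u h
  · rintro S' ⟨i, j, hj⟩
    obtain ⟨S₁, g, hg⟩ := exists_isBlowup S' (c S')
    have hsnd : IsBlowup (pullback.snd g j) ((c S').comap j) := hg.pullback_snd_of_flat j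
    rw [hloc j] at hsnd
    obtain ⟨i', j', hj'⟩ := hrec i _ _ hsnd
    exact ⟨S₁, g, hg, i', j' ≫ pullback.fst g j, inferInstance⟩

/-- **ONE CERTIFIED BLOWING UP PER CHART SUFFICES (family form):** blowing ups `π i : B i → U i` along `c (U i)` and open immersions `j i : U (next i) ⟶ B i` give `hrec` for every
blowing up (uniqueness of blowing ups). A period-two certificate is `ι := Bool`, `next := not`; an escalator is `ι := ℕ`, `next := (· + 1)`. [folklore] -/
theorem recurrent_family_of_one {c : (S : Scheme.{0}) → S.IdealSheafData} {ι : Type} (U : ι → Scheme.{0}) (next : ι → ι)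
    (B : ι → Scheme.{0}) (π : ∀ i, B i ⟶ U i) (hπ : ∀ i, IsBlowup (π i) (c (U i))) (j : ∀ i, U (next i) ⟶ B i) (hj : ∀ i, IsOpenImmersion (j i)) :
    ∀ (i : ι) (B' : Scheme.{0}) (π' : B' ⟶ U i), IsBlowup π' (c (U i)) → ∃ (i' : ι) (j' : U i' ⟶ B'), IsOpenImmersion j' := by
  intro i B' π' hπ'
  obtain ⟨e, -, -⟩ := (hπ i).unique hπ'
  haveI := hj i
  exact ⟨next i, j i ≫ e.hom, inferInstance⟩

/-- **THE RECURRENT-FAMILY LEMMA, CERTIFICATE FORM** (cycles of any period and escalators): charts `U i` with non-`Q` points, one blowing up `π i` of each along the recipe's centre,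
one open immersion `U (next i) ⟶ B i` each ⇒ no floor containing an open copy of some `U i` has a tower ending `Q`. [folklore assembly; OURS] -/
theorem not_exists_tower_of_recurrent_family₁ (Q : (S : Scheme.{0}) → S → Prop)
    (hQ : ∀ {X Y : Scheme.{0}} (π : X ⟶ Y) (x : X) [IsIso (π.stalkMap x)], Q Y (π.base x) → Q X x)
    (T : ℕ → Scheme.{0} → Prop) (c : (S : Scheme.{0}) → S.IdealSheafData)
    (h0 : ∀ (S : Scheme.{0}), T 0 S → ∀ s : S, Q S s)
    (hsucc : ∀ (n : ℕ) (S : Scheme.{0}), T (n + 1) S → ∀ (S₁ : Scheme.{0}) (g : S₁ ⟶ S), IsBlowup g (c S) → T n S₁)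
    (hloc : ∀ {U S : Scheme.{0}} (j : U ⟶ S) [IsOpenImmersion j], (c S).comap j = c U)
    {ι : Type} (U : ι → Scheme.{0}) (hU : ∀ i, ∃ u : U i, ¬ Q (U i) u) (next : ι → ι)
    (B : ι → Scheme.{0}) (π : ∀ i, B i ⟶ U i) (hπ : ∀ i, IsBlowup (π i) (c (U i))) (j : ∀ i, U (next i) ⟶ B i) (hj : ∀ i, IsOpenImmersion (j i))
    (S : Scheme.{0}) (hS : ∃ (i : ι) (j : U i ⟶ S), IsOpenImmersion j) : ¬ ∃ n : ℕ, T n S :=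
  not_exists_tower_of_recurrent_family Q hQ T c h0 hsucc hloc U hU (recurrent_family_of_one U next B π hπ j hj) S hS

/-- **REGULARITY VERSION, family form** (K-RR-a receiver for `RegTower.TowerRegular c p`; `T`, `c` abstract). [folklore assembly; OURS] -/
theorem not_exists_regularTower_of_recurrent_family₁ (T : ℕ → Scheme.{0} → Prop) (c : (S : Scheme.{0}) → S.IdealSheafData)
    (h0 : ∀ (S : Scheme.{0}), T 0 S → ∀ s : S, s ∈ Scheme.regularLocus S)
    (hsucc : ∀ (n : ℕ) (S : Scheme.{0}), T (n + 1) S → ∀ (S₁ : Scheme.{0}) (g : S₁ ⟶ S), IsBlowup g (c S) → T n S₁)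
    (hloc : ∀ {U S : Scheme.{0}} (j : U ⟶ S) [IsOpenImmersion j], (c S).comap j = c U)
    {ι : Type} (U : ι → Scheme.{0}) (hU : ∀ i, ∃ u : U i, u ∉ Scheme.regularLocus (U i)) (next : ι → ι)
    (B : ι → Scheme.{0}) (π : ∀ i, B i ⟶ U i) (hπ : ∀ i, IsBlowup (π i) (c (U i))) (j : ∀ i, U (next i) ⟶ B i) (hj : ∀ i, IsOpenImmersion (j i))
    (S : Scheme.{0}) (hS : ∃ (i : ι) (j : U i ⟶ S), IsOpenImmersion j) : ¬ ∃ n : ℕ, T n S :=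
  not_exists_tower_of_recurrent_family₁ (fun S s => s ∈ Scheme.regularLocus S) (fun π x _ h => mem_regularLocus_descends π x h)
    T c h0 hsucc hloc U hU next B π hπ j hj S hS

/-- **FULL VERSION, family form** (K-TT-a receiver for `IntrinsicTower.Recipes.RecipeTowerFull c p` and the v1 `IntrinsicTower.TowerFull p`; `T`, `c` abstract — instantiate with
`T := RecipeTowerFull c p`, `h0`/`hsucc := fun … h => h`, and `hloc` from §2). The period-two rad-τ cycle `L ⇄ M` (FB5-r7) would enter with `ι := Bool` ONCE (i) the two blowing
ups and open immersions are typed chartwise and (ii) the recipe's centre on `L`, `M` is identified in the kernel (test-ideal computation — NOT in the tree). [folklore assembly; OURS] -/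
theorem not_exists_fullTower_of_recurrent_family₁ (p : ℕ) (T : ℕ → Scheme.{0} → Prop) (c : (S : Scheme.{0}) → S.IdealSheafData)
    (h0 : ∀ (S : Scheme.{0}), T 0 S → ∀ s : S, FullCl p (S.presheaf.stalk s))
    (hsucc : ∀ (n : ℕ) (S : Scheme.{0}), T (n + 1) S → ∀ (S₁ : Scheme.{0}) (g : S₁ ⟶ S), IsBlowup g (c S) → T n S₁)
    (hloc : ∀ {U S : Scheme.{0}} (j : U ⟶ S) [IsOpenImmersion j], (c S).comap j = c U)
    {ι : Type} (U : ι → Scheme.{0}) (hU : ∀ i, ∃ u : U i, ¬ FullCl p ((U i).presheaf.stalk u)) (next : ι → ι)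
    (B : ι → Scheme.{0}) (π : ∀ i, B i ⟶ U i) (hπ : ∀ i, IsBlowup (π i) (c (U i))) (j : ∀ i, U (next i) ⟶ B i) (hj : ∀ i, IsOpenImmersion (j i))
    (S : Scheme.{0}) (hS : ∃ (i : ι) (j : U i ⟶ S), IsOpenImmersion j) : ¬ ∃ n : ℕ, T n S :=
  not_exists_tower_of_recurrent_family₁ (fun S s => FullCl p (S.presheaf.stalk s)) (fun π x _ h => fullCl_descends p π x h)
    T c h0 hsucc hloc U hU next B π hπ j hj S hS

/-! ## §2 Locality of the reduced-closure recipes along open immersions -/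

/-- Open immersions pull closures back to closures. [folklore] -/
theorem preimage_closure_of_isOpenImmersion {U S : Scheme.{0}} (j : U ⟶ S) [IsOpenImmersion j] (A : Set S) :
    j.base ⁻¹' closure A = closure (j.base ⁻¹' A) :=
  j.isOpenEmbedding.isOpenMap.preimage_closure_eq_closure_preimage j.continuous A

/-- **LOCALITY OF REDUCED-CLOSURE RECIPES.** For a point-locus `L` (a subset of every scheme) that pulls back along open immersions (`hL`), the recipe «vanishing ideal sheaf of the
closure of `L`» commutes with open immersions. [folklore] [cite: StacksProject, Tag 01J3] -/
theorem comap_vanishingIdeal_closure_of_isOpenImmersion (L : (S : Scheme.{0}) → Set S)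
    (hL : ∀ {U S : Scheme.{0}} (j : U ⟶ S) [IsOpenImmersion j], j.base ⁻¹' L S = L U)
    {U S : Scheme.{0}} (j : U ⟶ S) [IsOpenImmersion j] :
    (Scheme.IdealSheafData.vanishingIdeal ⟨closure (L S), isClosed_closure⟩).comap j =
      Scheme.IdealSheafData.vanishingIdeal ⟨closure (L U), isClosed_closure⟩ := by
  rw [comap_vanishingIdeal_of_isOpenImmersion]
  congr 1
  ext1
  rw [Closeds.coe_preimage]
  change j.base ⁻¹' closure (L S) = closure (L U)
  rw [preimage_closure_of_isOpenImmersion, hL j]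

/-- The singular locus pulls back along open immersions. [folklore] -/
theorem preimage_compl_regularLocus {U S : Scheme.{0}} (j : U ⟶ S) [IsOpenImmersion j] :
    j.base ⁻¹' (Scheme.regularLocus S)ᶜ = (Scheme.regularLocus U)ᶜ := by
  ext u
  simp only [Set.mem_preimage, Set.mem_compl_iff, mem_regularLocus_iff_of_flat_of_isPreimmersion j u]

/-- The non-FULL locus pulls back along open immersions. [folklore] -/
theorem preimage_nonFullLocus (p : ℕ) {U S : Scheme.{0}} (j : U ⟶ S) [IsOpenImmersion j] :
    j.base ⁻¹' IntrinsicTower.nonFullLocus p S = IntrinsicTower.nonFullLocus p U := by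
  ext u
  simp only [Set.mem_preimage, IntrinsicTower.nonFullLocus, Set.mem_setOf_eq]
  haveI : IsIso (j.stalkMap u) := isIso_stalkMap_of_flat_of_isPreimmersion j u
  exact not_congr ⟨fun h => FTemkinClosedPoints.fullCl_of_isIso_stalkMap' p j u h, fun h => FTemkinClosedPoints.fullCl_of_isIso_stalkMap p j u h⟩

/-- ★ **`RegTower.singCentre` IS LOCAL** (stated on its literal definition `vanishingIdeal ⟨closure (Reg S)ᶜ⟩`, so that `RegTower.singCentre p S` unfolds to it by `rfl`). [folklore] -/
theorem singCentre_local {U S : Scheme.{0}} (j : U ⟶ S) [IsOpenImmersion j] :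
    (Scheme.IdealSheafData.vanishingIdeal ⟨closure ((Scheme.regularLocus S)ᶜ), isClosed_closure⟩).comap j =
      Scheme.IdealSheafData.vanishingIdeal ⟨closure ((Scheme.regularLocus U)ᶜ), isClosed_closure⟩ :=
  comap_vanishingIdeal_closure_of_isOpenImmersion (fun S => (Scheme.regularLocus S)ᶜ) (fun j _ => preimage_compl_regularLocus j) j

/-- ★ **the v1 intrinsic centre `IntrinsicTower.centre p` IS LOCAL.** [folklore] -/
theorem intrinsicCentre_local (p : ℕ) {U S : Scheme.{0}} (j : U ⟶ S) [IsOpenImmersion j] :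
    (IntrinsicTower.centre p S).comap j = IntrinsicTower.centre p U :=
  comap_vanishingIdeal_closure_of_isOpenImmersion (fun S => IntrinsicTower.nonFullLocus p S) (fun j _ => preimage_nonFullLocus p j) j

/-- ★ **`IntrinsicTower.Recipes.nonFullCentre` IS LOCAL** (stated on its literal definition `vanishingIdeal ⟨closure (nonFullLocus p S ∩ (Reg S)ᶜ)⟩`). [folklore] -/
theorem nonFullCentreLiteral_local (p : ℕ) {U S : Scheme.{0}} (j : U ⟶ S) [IsOpenImmersion j] :
    (Scheme.IdealSheafData.vanishingIdeal ⟨closure (IntrinsicTower.nonFullLocus p S ∩ (Scheme.regularLocus S)ᶜ), isClosed_closure⟩).comap j =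
      Scheme.IdealSheafData.vanishingIdeal ⟨closure (IntrinsicTower.nonFullLocus p U ∩ (Scheme.regularLocus U)ᶜ), isClosed_closure⟩ :=
  comap_vanishingIdeal_closure_of_isOpenImmersion (fun S => IntrinsicTower.nonFullLocus p S ∩ (Scheme.regularLocus S)ᶜ)
    (fun j _ => by rw [Set.preimage_inter, preimage_nonFullLocus p j, preimage_compl_regularLocus j]) j

/-! ## §3 The receivers for the two tower predicates of record (literal forms) -/

/-- ★ **K-TT-a RECEIVER (v1 intrinsic tower):** a recurrent non-FULL chart refutes `∃ n, IntrinsicTower.TowerFull p n S` on every floor containing it. [OURS] -/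
theorem not_exists_towerFull_of_recurrent_chart (p : ℕ) (U₀ : Scheme.{0}) (hU₀ : ∃ u : U₀, ¬ FullCl p (U₀.presheaf.stalk u))
    (hrec : ∀ (B : Scheme.{0}) (π : B ⟶ U₀), IsBlowup π (IntrinsicTower.centre p U₀) → ∃ j : U₀ ⟶ B, IsOpenImmersion j)
    (S : Scheme.{0}) (hS : ∃ j : U₀ ⟶ S, IsOpenImmersion j) : ¬ ∃ n : ℕ, IntrinsicTower.TowerFull p n S :=
  not_exists_tower_of_recurrent_chart (fun S s => FullCl p (S.presheaf.stalk s)) (fun π x _ h => fullCl_descends p π x h)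
    (IntrinsicTower.TowerFull p) (IntrinsicTower.centre p) (fun _ h => h) (fun _ _ h => h) (fun j _ => intrinsicCentre_local p j) U₀ hU₀ hrec S hS

/-- ★ **K-TT-a RECEIVER, ONE-CHART FORM (v1 intrinsic tower):** one blowing up of the non-FULL chart `U₀` along `IntrinsicTower.centre p U₀` receiving an open copy of `U₀` refutes
`∃ n, IntrinsicTower.TowerFull p n S` on every floor `S` containing an open copy of `U₀` — the kernel landing shape of the d4lx6c3 period-one loop (res-L1-w45a-idea-1 FB5-r6 §1.5,
replayed by res-L1-w45a-tri-2), MODULO the chart-level identification of the centre (Fedder / FULL ⟺ F-pure on Gorenstein charts; R19.7-DEFERRED-1). [OURS] -/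
theorem not_exists_towerFull_of_recurrent_chart₁ (p : ℕ) (U₀ : Scheme.{0}) (hU₀ : ∃ u : U₀, ¬ FullCl p (U₀.presheaf.stalk u))
    {B₀ : Scheme.{0}} {π₀ : B₀ ⟶ U₀} (hπ₀ : IsBlowup π₀ (IntrinsicTower.centre p U₀)) (j₀ : U₀ ⟶ B₀) [IsOpenImmersion j₀]
    (S : Scheme.{0}) (hS : ∃ j : U₀ ⟶ S, IsOpenImmersion j) : ¬ ∃ n : ℕ, IntrinsicTower.TowerFull p n S :=
  not_exists_towerFull_of_recurrent_chart p U₀ hU₀ (forall_isBlowup_exists_isOpenImmersion_of_one _ hπ₀ j₀) S hS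

end Summit.ResolutionOfSingularities.ResolutionOfSingularities.Theorems.FInjectiveMacaulayfication.FullCentreDescent

end
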